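import Literature.Computability.MetaComplexity.TseitinDepthFregeTransfer
import Literature.Computability.MetaComplexity.KEvaluationsOnto
import HarnessLib

/-!
# Bounded-depth Frege kit for reductions TO the bijective pigeonhole principle

Support layer (one-sided sequents `TextbookFrege.disjList`, bounded derivations `TextbookFrege.BD`)
for reductions that derive the substituted axioms of a hard formula from the clauses of the
bijective pigeonhole principle `ontoPHP^{N+1}_N` (`ontoPigeonholeCNF (N+1) N`): Krajíček 2019,
§15.4 ("manipulating the size of the universe") and Ben-Sasson 2002 (Tseitin formulas). With
`R = ⋀ ontoPHP^{N+1}_N` (`ophp N`) and atoms `p_{b,a} = var (b·N + a)` (`pv N b a`):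

* size / depth facts of `R`; the four clause families and their extraction as sequents:
  `pigeonS` (`⊢ p_{b,0}, …, p_{b,N-1}, ¬R`), `ontoS` (`⊢ p_{0,a}, …, p_{N,a}, ¬R`),
  `holeS` (`⊢ ¬p_{b,a}, ¬p_{b',a}, ¬R`), `funcS` (`⊢ ¬p_{b,a}, ¬p_{b,a'}, ¬R`);
* `negConjListS` — `⊢ ¬z₁, …, ¬z_t, L` gives `⊢ ¬⋀[z₁,…,z_t], L`;
* two-sorted case distribution: the case forms `forms N Bl Al` (one conjunction of atoms per
  choice of a hole for every pigeon of `Bl` and a pigeon for every hole of `Al`), their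
  description `mem_forms_iff`, and `formsS` (`⊢ forms, ¬R`: some case holds), by distributing the
  pigeon and onto clauses (`TextbookFrege.productS`), as in `KrajicekRamsey.asgFormsS` but with
  plain atoms (functionality is an axiom of `ontoPHP`, no least-hole formulas are needed) and with
  holes as a second sort.

All line counts are explicit polynomials in `N`; the depth parameter is a constant.

References: J. Krajíček, *Proof complexity*, CUP 2019, §15.4 (proof of Lemma 15.4.3, Claims 1–2:
the distribution over assignments and the refutation of each assignment); E. Ben-Sasson, *Hard
examples for the bounded depth Frege proof system*, Comput. Complexity 11 (2002), §3–4. The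
sequent bookkeeping is folklore (Shoenfield 1967, §3.1).
-/

namespace Literature.Computability.MetaComplexity

open Complexity Complexity.PropForm TextbookFrege


open KrajicekRamsey (litOf clauseOf ofCNF_eq_conjList clauseExtractS dd_clauseOf_le dd_ofCNF_le
  dd_neg_ofCNF_le msum_map_var)

namespace OntoPHPReduction

/-! ### The target formula and its atoms -/

section Defs

variable (N : ℕ)

/-- The pigeonhole atom `p_{b,a}` ("pigeon `b` sits in hole `a`") of `ontoPHP^{N+1}_N`: the variable
`b·N + a`. [cite: KrajicekProofComplexity2019, §15.4 (the atoms p_{ij} of ontoPHP_n)] -/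
def pv (b a : ℕ) : PropForm ℕ :=
  var (b * N + a)

/-- `R = ⋀ ontoPHP^{N+1}_N`, the rendered bijective pigeonhole CNF; `¬R` is the tautology
`ontoPigeonholeForm (N+1) N`. [cite: KrajicekProofComplexity2019, §15.4 (¬ontoPHP_n as a hypothesis)] -/
def ophp : PropForm ℕ :=
  PropForm.ofCNF (ontoPigeonholeCNF (N + 1) N)

end Defs

variable {N : ℕ}

/-- The bijective pigeonhole tautology is `¬R`. [folklore] -/
theorem ontoPigeonholeForm_eq : ontoPigeonholeForm (N + 1) N = neg (ophp N) := rfl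

/-- Atoms have size one. [folklore] -/
@[simp] theorem size_pv (b a : ℕ) : (pv N b a).size = 1 := rfl

/-- Atoms have disjunct depth zero. [folklore] -/
@[simp] theorem dd_pv (b a : ℕ) : (pv N b a).dd = 0 := by simp [pv]

/-- Atoms have all auxiliary depths zero. [folklore] -/
@[simp] theorem altDepthAux_pv (c b a : ℕ) : altDepthAux c (pv N b a) = 0 := by simp [pv]

/-- `R` has disjunct depth at most `3`. [folklore] -/
theorem dd_ophp_le : (ophp N).dd ≤ 3 := dd_ofCNF_le _

/-- `¬R` has disjunct depth at most `4`. [folklore] -/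
theorem dd_neg_ophp_le : (neg (ophp N)).dd ≤ 4 := dd_neg_ofCNF_le _

/-- `R` has auxiliary depth at most `3` below a negation. [folklore] -/
theorem altDepthAux_one_ophp_le : altDepthAux 1 (ophp N) ≤ 3 :=
  Complexity.altDepthAux_one_ofCNF_le _

/-! ### The four clause families -/

/-- Pigeon (totality) clauses belong to `ontoPHP`. [folklore] -/
theorem pigeonClause_mem {b : ℕ} (hb : b < N + 1) :
    ((List.range N).map fun a => (b * N + a, true)) ∈ ontoPigeonholeCNF (N + 1) N :=
  mem_ontoPigeonholeCNF_iff.2 (Or.inl (KEval.mem_pigeonholeCNF_iff.2 (Or.inl ⟨b, hb, rfl⟩)))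

/-- Hole (injectivity) clauses belong to `ontoPHP`. [folklore] -/
theorem holeClause_mem {b b' a : ℕ} (hbb' : b < b') (hb' : b' < N + 1) (ha : a < N) :
    [(b * N + a, false), (b' * N + a, false)] ∈ ontoPigeonholeCNF (N + 1) N :=
  mem_ontoPigeonholeCNF_iff.2 (Or.inl (KEval.mem_pigeonholeCNF_iff.2
    (Or.inr ⟨a, ha, b', hb', b, hbb', rfl⟩)))

/-- Functionality clauses belong to `ontoPHP`. [folklore] -/
theorem funcClause_mem {b a a' : ℕ} (hb : b < N + 1) (haa' : a < a') (ha' : a' < N) :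
    [(b * N + a, false), (b * N + a', false)] ∈ ontoPigeonholeCNF (N + 1) N :=
  mem_ontoPigeonholeCNF_iff.2 (Or.inr (Or.inl ⟨b, hb, a', ha', a, haa', rfl⟩))

/-- Onto clauses belong to `ontoPHP`. [folklore] -/
theorem ontoClause_mem {a : ℕ} (ha : a < N) :
    ((List.range (N + 1)).map fun b => (b * N + a, true)) ∈ ontoPigeonholeCNF (N + 1) N :=
  mem_ontoPigeonholeCNF_iff.2 (Or.inr (Or.inr ⟨a, ha, rfl⟩))

/-- Rendering of a pigeon clause. [folklore] -/
theorem clauseOf_pigeonClause (b : ℕ) :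
    clauseOf ((List.range N).map fun a => (b * N + a, true)) =
      disjList ((List.range N).map fun a => pv N b a) := by
  simp [clauseOf, litOf, pv, List.map_map, Function.comp_def]

/-- Rendering of an onto clause. [folklore] -/
theorem clauseOf_ontoClause (a : ℕ) :
    clauseOf ((List.range (N + 1)).map fun b => (b * N + a, true)) =
      disjList ((List.range (N + 1)).map fun b => pv N b a) := by
  simp [clauseOf, litOf, pv, List.map_map, Function.comp_def]

/-- Rendering of a two-literal negative clause. [folklore] -/
theorem clauseOf_pair (x y : ℕ) :
    clauseOf [(x, false), (y, false)] = disjList [neg (var x), neg (var y)] := by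
  simp [clauseOf, litOf]

/-! ### Size of the target -/

/-- A sum of bounded terms. [folklore] -/
theorem sum_map_le_length_mul {α : Type*} (l : List α) (f : α → ℕ) {n : ℕ}
    (h : ∀ x ∈ l, f x ≤ n) : (l.map f).sum ≤ l.length * n := by
  induction l with
  | nil => simp
  | cons a l ih =>
    simp only [List.map_cons, List.sum_cons, List.length_cons]
    have h1 := h a List.mem_cons_self
    have h2 := ih fun x hx => h x (List.mem_cons_of_mem _ hx)
    nlinarith

/-- `ontoPHP^{N+1}_N` has at most `4 (N+1)³` clauses. [folklore] -/
theorem length_ontoPigeonholeCNF_le : (ontoPigeonholeCNF (N + 1) N).length ≤ 4 * (N + 1) ^ 3 := by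
  unfold ontoPigeonholeCNF
  rw [List.length_append, List.length_append, length_pigeonholeCNF, List.length_map,
    List.length_range, List.length_flatMap]
  have hch : (N + 1).choose 2 ≤ (N + 1) ^ 2 := Nat.choose_le_pow _ _
  simp only [List.length_flatMap, List.length_map, List.length_range]
  have hfun : ((List.range (N + 1)).map fun i => ((List.range N).map fun j' => j').sum).sum ≤
      (N + 1) * (N * N) := by
    have := sum_map_le_length_mul (List.range (N + 1))
      (fun i => ((List.range N).map fun j' => j').sum) (n := N * N) (fun i _ => by
        have := sum_map_le_length_mul (List.range N) (fun j' => j') (n := N)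
          (fun j' hj' => (List.mem_range.1 hj').le)
        rwa [List.length_range] at this)
    rwa [List.length_range] at this
  have e3 : (N + 1) ^ 3 = (N + 1) * (N + 1) * (N + 1) := by ring
  have e2 : (N + 1) ^ 2 = (N + 1) * (N + 1) := by ring
  rw [e2] at hch
  nlinarith

/-- Every rendered clause of `ontoPHP^{N+1}_N` has size `≤ 2N + 7`. [folklore] -/
theorem size_clauseOf_le_of_mem {c : Clause ℕ} (hc : c ∈ ontoPigeonholeCNF (N + 1) N) :
    (clauseOf c).size + 1 ≤ 2 * N + 8 := by
  rcases mem_ontoPigeonholeCNF_iff.1 hc with hc | ⟨i, -, j', -, j, -, rfl⟩ | ⟨j, -, rfl⟩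
  · rcases KEval.mem_pigeonholeCNF_iff.1 hc with ⟨i, -, rfl⟩ | ⟨j, -, i', -, i, -, rfl⟩
    · rw [clauseOf_pigeonClause, size_disjList_eq_msum]
      have := msum_map_var (fun a => i * N + a) (List.range N)
      simp only [pv]
      rw [this, List.length_range]; omega
    · rw [clauseOf_pair]; simp [size]
  · rw [clauseOf_pair]; simp [size]
  · rw [clauseOf_ontoClause, size_disjList_eq_msum]
    have := msum_map_var (fun b => b * N + j) (List.range (N + 1))
    simp only [pv]
    rw [this, List.length_range]; omega

/-- The member sum of the rendered clauses of `ontoPHP^{N+1}_N` is at most `32 (N+1)⁴`. [folklore] -/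
theorem msum_ontoClauses_le :
    msum ((ontoPigeonholeCNF (N + 1) N).map clauseOf) ≤ 32 * (N + 1) ^ 4 := by
  have h1 : msum ((ontoPigeonholeCNF (N + 1) N).map clauseOf) ≤
      ((ontoPigeonholeCNF (N + 1) N).map clauseOf).length * (2 * N + 8) :=
    msum_le_length_mul fun X hX => by
      obtain ⟨c, hc, rfl⟩ := List.mem_map.1 hX
      exact size_clauseOf_le_of_mem hc
  rw [List.length_map] at h1
  have h2 := length_ontoPigeonholeCNF_le (N := N)
  have h3 : 4 * (N + 1) ^ 3 * (2 * N + 8) ≤ 32 * (N + 1) ^ 4 := by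
    have : 2 * N + 8 ≤ 8 * (N + 1) := by omega
    calc 4 * (N + 1) ^ 3 * (2 * N + 8) ≤ 4 * (N + 1) ^ 3 * (8 * (N + 1)) :=
          Nat.mul_le_mul_left _ this
      _ = 32 * (N + 1) ^ 4 := by ring
  calc msum _ ≤ (ontoPigeonholeCNF (N + 1) N).length * (2 * N + 8) := h1
    _ ≤ 4 * (N + 1) ^ 3 * (2 * N + 8) := Nat.mul_le_mul_right _ h2
    _ ≤ 32 * (N + 1) ^ 4 := h3

/-- The size of `R`. [folklore] -/
theorem size_ophp_le : (ophp N).size ≤ 32 * (N + 1) ^ 4 + 1 := by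
  rw [ophp, ofCNF_eq_conjList, size_conjList_eq_msum]
  have := msum_ontoClauses_le (N := N)
  omega

/-- `16 ≤ (N+1)^4` once `N ≥ 1`. [folklore] -/
theorem sixteen_le_pow (hN : 1 ≤ N) : 16 ≤ (N + 1) ^ 4 :=
  calc 16 = 2 ^ 4 := by norm_num
    _ ≤ (N + 1) ^ 4 := Nat.pow_le_pow_left (by omega) 4

/-! ### Clause extraction as sequents

Throughout, the size parameter must satisfy `B ≥ 1000 (N+1)^4` and the depth parameter `D ≥ 12`;
the line counts are bounded by `extractLines N = 10⁴ (N+2)⁴`. -/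

/-- A uniform line budget for the extraction of one clause of `ontoPHP` in the four shapes below.
[folklore] -/
def extractLines (N : ℕ) : ℕ :=
  10000 * (N + 2) ^ 4

variable {D B : ℕ}

/-- The raw extraction `⊢ ¬R, C` of a clause `C` of `ontoPHP`. [folklore] -/
theorem extractS {c : Clause ℕ} (hc : c ∈ ontoPigeonholeCNF (N + 1) N) (hD : 8 ≤ D)
    (hB : 1000 * (N + 1) ^ 4 ≤ B) :
    BD D B (130 * (32 * (N + 1) ^ 4 + 3)) (disjList [neg (ophp N), clauseOf c]) := by
  have h16 : 1 ≤ (N + 1) ^ 4 := Nat.one_le_pow _ _ (by omega)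
  exact clauseExtractS hc (by have := msum_ontoClauses_le (N := N); omega) hD (by omega)

/-- **A wide positive clause as a flat sequent**: from `⊢ ¬R, ⋁U` to `⊢ U, ¬R` for a list `U`
of atoms of length `≤ N + 1`. [folklore] -/
theorem wideS {U : List (PropForm ℕ)} (h : BD D B (130 * (32 * (N + 1) ^ 4 + 3))
      (disjList [neg (ophp N), disjList U]))
    (hU : ∀ X ∈ U, X.size = 1 ∧ X.dd = 0) (hlen : U.length ≤ N + 1) (hD : 12 ≤ D)
    (hB : 1000 * (N + 1) ^ 4 ≤ B) : BD D B (extractLines N) (disjList (U ++ [neg (ophp N)])) := by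
  have hR := size_ophp_le (N := N)
  have hmsU : msum U ≤ 2 * (N + 1) := by
    have := msum_le_length_mul (L := U) (W := 2) fun X hX => by rw [(hU X hX).1]
    omega
  have hddU : (disjList U).dd ≤ 0 := dd_disjList_le fun X hX => (hU X hX).2.le
  have h16 : 1 ≤ (N + 1) ^ 4 := Nat.one_le_pow _ _ (by omega)
  have hN4 : N + 1 ≤ (N + 1) ^ 4 := Nat.le_self_pow (by norm_num) _
  -- swap the two members
  have h1 : BD D B (130 * (32 * (N + 1) ^ 4 + 3) + 50 * (2 + 1) ^ 2)
      (disjList [disjList U, neg (ophp N)]) := by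
    refine subsetN (N := 2) h (by simp) (p := 4) ?_ (by omega) ?_ (by simp) (by simp)
    · intro X hX
      simp only [List.mem_cons, List.not_mem_nil, or_false] at hX
      rcases hX with rfl | rfl
      · exact hddU.trans (by omega)
      · exact dd_neg_ophp_le
    · simp only [size_disjList_eq_msum, msum_cons, msum_nil, size]; omega
  -- flatten
  have h2 := flattenAllS U (L := [neg (ophp N)]) h1 (p := 4) ?_ (by omega) (N := N + 5)
    (by simp; omega) ?_
  rotate_left
  · intro X hX
    rcases List.mem_append.1 hX with hX | hX
    · exact (hU X hX).2.le.trans (by omega)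
    · simp only [List.mem_singleton] at hX; subst hX; exact dd_neg_ophp_le
  · simp only [msum_append, msum_cons, msum_nil, size]; omega
  refine h2.mono ?_
  unfold extractLines
  have e : (N + 5 + 1) ^ 3 ≤ (N + 2) ^ 3 * 27 := by
    have : N + 6 ≤ 3 * (N + 2) := by omega
    calc (N + 5 + 1) ^ 3 = (N + 6) ^ 3 := by ring
      _ ≤ (3 * (N + 2)) ^ 3 := Nat.pow_le_pow_left this 3
      _ = (N + 2) ^ 3 * 27 := by ring
  have e2 : (N + 1) ^ 4 ≤ (N + 2) ^ 4 := Nat.pow_le_pow_left (by omega) 4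
  have e3 : (N + 2) ^ 3 ≤ (N + 2) ^ 4 := Nat.pow_le_pow_right (by omega) (by omega)
  nlinarith [e, e2, e3]

/-- **Pigeon clause** `⊢ p_{b,0}, …, p_{b,N-1}, ¬R` for a pigeon `b ≤ N`.
[cite: KrajicekProofComplexity2019, §15.4 (proof of Lemma 15.4.3: the axioms of ¬ontoPHP_n used in Claim 1)] -/
theorem pigeonS {b : ℕ} (hb : b < N + 1) (hD : 12 ≤ D) (hB : 1000 * (N + 1) ^ 4 ≤ B) :
    BD D B (extractLines N) (disjList (((List.range N).map (pv N b)) ++ [neg (ophp N)])) := by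
  have h := extractS (D := D) (pigeonClause_mem hb) (by omega) hB
  rw [clauseOf_pigeonClause] at h
  exact wideS h (fun X hX => by obtain ⟨a, -, rfl⟩ := List.mem_map.1 hX; simp) (by simp) hD hB

/-- **Onto clause** `⊢ p_{0,a}, …, p_{N,a}, ¬R` for a hole `a < N`.
[cite: KrajicekProofComplexity2019, §15.4 (proof of Lemma 15.4.3)] -/
theorem ontoS {a : ℕ} (ha : a < N) (hD : 12 ≤ D) (hB : 1000 * (N + 1) ^ 4 ≤ B) :
    BD D B (extractLines N)
      (disjList (((List.range (N + 1)).map fun b => pv N b a) ++ [neg (ophp N)])) := by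
  have h := extractS (D := D) (ontoClause_mem ha) (by omega) hB
  rw [clauseOf_ontoClause] at h
  exact wideS h (fun X hX => by obtain ⟨b, -, rfl⟩ := List.mem_map.1 hX; simp) (by simp) hD hB

/-- **A two-literal negative clause as a flat sequent** `⊢ ¬x, ¬y, ¬R`. [folklore] -/
theorem pairS {x y : ℕ} (hc : [(x, false), (y, false)] ∈ ontoPigeonholeCNF (N + 1) N)
    (hD : 12 ≤ D) (hB : 1000 * (N + 1) ^ 4 ≤ B) :
    BD D B (extractLines N) (disjList [neg (var x), neg (var y), neg (ophp N)]) := by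
  have hR := size_ophp_le (N := N)
  have h16 : 1 ≤ (N + 1) ^ 4 := Nat.one_le_pow _ _ (by omega)
  have hN4 : N + 1 ≤ (N + 1) ^ 4 := Nat.le_self_pow (by norm_num) _
  have h := extractS (D := D) hc (by omega) hB
  rw [clauseOf_pair] at h
  have h1 : BD D B (130 * (32 * (N + 1) ^ 4 + 3) + 50 * (2 + 1) ^ 2)
      (disjList [disjList [neg (var x), neg (var y)], neg (ophp N)]) := by
    refine subsetN (N := 2) h (by simp) (p := 4) ?_ (by omega) ?_ (by simp) (by simp)
    · intro X hX
      simp only [List.mem_cons, List.not_mem_nil, or_false] at hX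
      rcases hX with rfl | rfl
      · simp
      · exact dd_neg_ophp_le
    · simp only [size_disjList_eq_msum, msum_cons, msum_nil, size]; omega
  have h2 := flattenAllS [neg (var x), neg (var y)] (L := [neg (ophp N)]) h1 (p := 4) ?_ (by omega)
    (N := 6) (by simp) ?_
  rotate_left
  · intro X hX
    simp only [List.mem_append, List.mem_cons, List.not_mem_nil, or_false] at hX
    rcases hX with (rfl | rfl) | rfl
    · simp
    · simp
    · exact dd_neg_ophp_le
  · simp only [msum_append, msum_cons, msum_nil, size]; omega
  refine h2.mono ?_
  unfold extractLines
  have e2 : (N + 1) ^ 4 ≤ (N + 2) ^ 4 := Nat.pow_le_pow_left (by omega) 4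
  have e4 : 16 ≤ (N + 2) ^ 4 :=
    calc 16 = 2 ^ 4 := by norm_num
      _ ≤ (N + 2) ^ 4 := Nat.pow_le_pow_left (by omega) 4
  nlinarith [e2, e4]

/-- **Hole clause** `⊢ ¬p_{b,a}, ¬p_{b',a}, ¬R` for distinct pigeons `b, b'` and a hole `a`.
[cite: KrajicekProofComplexity2019, §15.4 (proof of Lemma 15.4.3, Claim 2: two pigeons in one hole)] -/
theorem holeS {b b' a : ℕ} (hne : b ≠ b') (hb : b < N + 1) (hb' : b' < N + 1) (ha : a < N)
    (hD : 12 ≤ D) (hB : 1000 * (N + 1) ^ 4 ≤ B) :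
    BD D B (extractLines N + 800) (disjList [neg (pv N b a), neg (pv N b' a), neg (ophp N)]) := by
  have hR := size_ophp_le (N := N)
  have h16 : 1 ≤ (N + 1) ^ 4 := Nat.one_le_pow _ _ (by omega)
  rcases Nat.lt_or_gt_of_ne hne with hlt | hlt
  · exact (pairS (holeClause_mem hlt hb' ha) hD hB).mono (by omega)
  · have h := pairS (holeClause_mem hlt hb ha) hD hB
    refine (subsetN (N := 3) h ?_ (p := 4) ?_ (by omega) ?_ (by simp) (by simp)).mono (by omega)
    · intro X hX
      simp only [List.mem_cons, List.not_mem_nil, or_false, pv] at hX ⊢; tauto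
    · intro X hX
      simp only [List.mem_cons, List.not_mem_nil, or_false] at hX
      rcases hX with rfl | rfl | rfl
      · simp
      · simp
      · exact dd_neg_ophp_le
    · simp only [size_disjList_eq_msum, msum_cons, msum_nil, size, pv]; omega

/-- **Functionality clause** `⊢ ¬p_{b,a}, ¬p_{b,a'}, ¬R` for a pigeon `b` and distinct holes
`a, a'`. [cite: KrajicekProofComplexity2019, §15.4 (proof of Lemma 15.4.3: functionality of the assignment)] -/
theorem funcS {b a a' : ℕ} (hb : b < N + 1) (hne : a ≠ a') (ha : a < N) (ha' : a' < N)
    (hD : 12 ≤ D) (hB : 1000 * (N + 1) ^ 4 ≤ B) :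
    BD D B (extractLines N + 800) (disjList [neg (pv N b a), neg (pv N b a'), neg (ophp N)]) := by
  have hR := size_ophp_le (N := N)
  have h16 : 1 ≤ (N + 1) ^ 4 := Nat.one_le_pow _ _ (by omega)
  rcases Nat.lt_or_gt_of_ne hne with hlt | hlt
  · exact (pairS (funcClause_mem hb hlt ha') hD hB).mono (by omega)
  · have h := pairS (funcClause_mem hb hlt ha) hD hB
    refine (subsetN (N := 3) h ?_ (p := 4) ?_ (by omega) ?_ (by simp) (by simp)).mono (by omega)
    · intro X hX
      simp only [List.mem_cons, List.not_mem_nil, or_false, pv] at hX ⊢; tauto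
    · intro X hX
      simp only [List.mem_cons, List.not_mem_nil, or_false] at hX
      rcases hX with rfl | rfl | rfl
      · simp
      · simp
      · exact dd_neg_ophp_le
    · simp only [size_disjList_eq_msum, msum_cons, msum_nil, size, pv]; omega


/-! ### Negated conjunction of a list of units -/

/-- **`⊢ ¬z₁, …, ¬z_t, L` gives `⊢ ¬⋀[z₁, …, z_t], L`** (iterated `consNegConjS`, with the
structural rearrangements; `Nn ≥ |Z| + |L| + 3` bounds all sequent lengths).
[Shoenfield 1967, §3.1 (case `¬∧`, iterated)] [folklore] -/
theorem negConjListS {p Nn : ℕ} (Z : List (PropForm ℕ)) {L : List (PropForm ℕ)} {ℓ : ℕ}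
    (h : BD D B ℓ (disjList ((Z.map neg) ++ L)))
    (hp : ∀ X ∈ Z ++ L, X.dd ≤ p) (hpn : ∀ z ∈ Z, (neg z).dd ≤ p) (hD : p + 7 ≤ D)
    (hN : Z.length + L.length + 3 ≤ Nn) (hs : 16 * (2 * msum Z + msum L) + 40 ≤ B) :
    BD D B (ℓ + (Z.length + 1) * (110 * (Nn + 1) ^ 2)) (disjList (neg (conjList Z) :: L)) := by
  induction Z generalizing L ℓ with
  | nil =>
    simp only [List.map_nil, List.nil_append] at h hp
    simp only [List.length_nil] at hN ⊢
    rw [conjList_nil]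
    have hsL : (disjList L).size = msum L + 1 := size_disjList_eq_msum L
    refine (subsetN (N := Nn) (L' := neg (const true) :: L) h
      (fun A hA => List.mem_cons_of_mem _ hA) ?_ (p := p + 1) (by omega) ?_ (by omega)
      (by rw [List.length_cons]; omega)).mono ?_
    · intro X hX
      rcases List.mem_cons.1 hX with rfl | hX
      · simp
      · exact (hp X hX).trans (by omega)
    · rw [size_disjList_cons]; simp only [size, msum_nil] at hs ⊢; omega
    · nlinarith
  | cons z Z ih =>
    simp only [List.map_cons, List.cons_append] at h
    simp only [List.length_cons] at hN ⊢
    have hz : z.dd ≤ p := hp z (by simp)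
    have hnz : (neg z).dd ≤ p := hpn z List.mem_cons_self
    have hpZ : ∀ X ∈ Z, X.dd ≤ p := fun X hX => hp X (by simp [hX])
    have hpL : ∀ X ∈ L, X.dd ≤ p := fun X hX => hp X (by simp [hX])
    have hcZ : (conjList Z).dd ≤ p + 2 := dd_conjList_le hpZ
    have hdL : (disjList L).dd ≤ p := dd_disjList_le hpL
    have hndL : (neg (disjList L)).dd ≤ p + 2 := dd_neg_disjList_le hpL
    have hmsn : msum (Z.map neg) = msum Z + Z.length := by
      clear h hp hpn hN hs ih hz hnz hpZ hcZ
      induction Z with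
      | nil => simp
      | cons y Z ih' => simp only [List.map_cons, msum_cons, size, List.length_cons]; rw [ih']; omega
    have hlenZ : Z.length ≤ msum Z := length_le_msum Z
    simp only [msum_cons] at hs
    -- `⊢ ¬Z…, ¬z, L`
    have h1 : BD D B (ℓ + 50 * (Nn + 1) ^ 2) (disjList ((Z.map neg) ++ (neg z :: L))) := by
      refine subsetN (N := Nn) h (fun A hA => ?_) (p := p) ?_ (by omega) ?_
        (by simp only [List.length_cons, List.length_append, List.length_map]; omega)
        (by simp only [List.length_cons, List.length_append, List.length_map]; omega)
      · simp only [List.mem_cons, List.mem_append] at hA ⊢; tauto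
      · intro X hX
        simp only [List.mem_append, List.mem_cons, List.mem_map] at hX
        rcases hX with ⟨y, hy, rfl⟩ | rfl | hX
        · exact hpn y (List.mem_cons_of_mem _ hy)
        · exact hnz
        · exact hpL X hX
      · simp only [size_disjList_eq_msum, msum_cons, msum_append, size, hmsn]; omega
    -- `⊢ ¬⋀Z, ¬z, L`
    have h2 := ih (L := neg z :: L) h1 (fun X hX => by
        simp only [List.mem_append, List.mem_cons] at hX
        rcases hX with hX | rfl | hX
        · exact hpZ X hX
        · exact hnz
        · exact hpL X hX) (fun y hy => hpn y (List.mem_cons_of_mem _ hy))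
      (by rw [List.length_cons]; omega) (by simp only [msum_cons, size]; omega)
    -- `⊢ ¬z, ¬⋀Z, L`
    have h3 : BD D B (ℓ + 50 * (Nn + 1) ^ 2 + (Z.length + 1) * (110 * (Nn + 1) ^ 2) +
        50 * (Nn + 1) ^ 2) (disjList (neg z :: neg (conjList Z) :: L)) := by
      refine subsetN (N := Nn) h2 (fun A hA => ?_) (p := p + 3) ?_ (by omega) ?_
        (by simp only [List.length_cons]; omega) (by simp only [List.length_cons]; omega)
      · simp only [List.mem_cons] at hA ⊢; tauto
      · intro X hX
        simp only [List.mem_cons] at hX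
        rcases hX with rfl | rfl | hX
        · exact hnz.trans (by omega)
        · exact dd_neg_conjList_le hpZ
        · exact (hpL X hX).trans (by omega)
      · simp only [size_disjList_eq_msum, msum_cons, size, size_conjList_eq_msum]; omega
    have h4 := consNegConjS h3 (by omega) (by omega) (by omega)
      (by rw [size_conjList_eq_msum, size_disjList_eq_msum]; omega)
    rw [← conjList_cons] at h4
    refine h4.mono ?_
    have e : (Z.length + 1 + 1) * (110 * (Nn + 1) ^ 2) =
        (Z.length + 1) * (110 * (Nn + 1) ^ 2) + 110 * (Nn + 1) ^ 2 := by ring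
    have : 1 ≤ (Nn + 1) ^ 2 := Nat.one_le_pow _ _ (by omega)
    rw [e]; omega

/-! ### Case forms: one conjunction of atoms per local assignment -/

section Forms

variable (N : ℕ)

/-- The case forms over a list `Bl` of pigeons: for every choice of a hole `a_b < N` for every
`b ∈ Bl`, the conjunction `⋀_b p_{b,a_b}` (generated by the recursion of `TextbookFrege.productS`).
[cite: KrajicekProofComplexity2019, §15.4 (proof of Lemma 15.4.3, Claim 1: the disjunction over assignments)] -/
def formsP : List ℕ → List (PropForm ℕ)
  | [] => [const true]
  | b :: Bl => (formsP Bl).flatMap fun y => ((List.range N).map fun a => pv N b a).map fun x => conj x y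

/-- The two-sorted case forms over pigeons `Bl` and holes `Al`: for every choice of a hole for
every pigeon of `Bl` AND of a pigeon `b_a ≤ N` for every hole `a ∈ Al`, the conjunction of the
chosen atoms (hole choices outermost). [cite: KrajicekProofComplexity2019, §15.4 (proof of Lemma 15.4.3, Claim 1)] -/
def forms (Bl : List ℕ) : List ℕ → List (PropForm ℕ)
  | [] => formsP N Bl
  | a :: Al => (forms Bl Al).flatMap fun y => ((List.range (N + 1)).map fun b => pv N b a).map fun x => conj x y

/-- The atoms of a case: the chosen pigeons `gl` of the holes `Al`, then the chosen holes `fl` of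
the pigeons `Bl`. [folklore] -/
def caseUnits (Bl Al gl fl : List ℕ) : List (PropForm ℕ) :=
  List.zipWith (fun a b => pv N b a) Al gl ++ List.zipWith (fun b a => pv N b a) Bl fl

end Forms

/-- **Every case form is the conjunction of its case units** (pigeon sort).
[folklore] -/
theorem exists_of_mem_formsP {Bl : List ℕ} {φ : PropForm ℕ} (h : φ ∈ formsP N Bl) :
    ∃ fl : List ℕ, fl.length = Bl.length ∧ (∀ a ∈ fl, a < N) ∧
      φ = conjList (List.zipWith (fun b a => pv N b a) Bl fl) := by
  induction Bl generalizing φ with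
  | nil =>
    simp only [formsP, List.mem_singleton] at h
    exact ⟨[], rfl, by simp, by rw [h]; rfl⟩
  | cons b Bl ih =>
    simp only [formsP, List.mem_flatMap, List.map_map, List.mem_map, Function.comp] at h
    obtain ⟨y, hy, a, ha, rfl⟩ := h
    obtain ⟨fl, hfl, hfN, rfl⟩ := ih hy
    refine ⟨a :: fl, by simp [hfl], fun a' ha' => ?_, rfl⟩
    rcases List.mem_cons.1 ha' with rfl | ha'
    · exact List.mem_range.1 ha
    · exact hfN a' ha'

/-- **Every two-sorted case form is the conjunction of its case units.** [folklore] -/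
theorem exists_of_mem_forms {Bl Al : List ℕ} {φ : PropForm ℕ} (h : φ ∈ forms N Bl Al) :
    ∃ gl fl : List ℕ, gl.length = Al.length ∧ fl.length = Bl.length ∧ (∀ b ∈ gl, b < N + 1) ∧
      (∀ a ∈ fl, a < N) ∧ φ = conjList (caseUnits N Bl Al gl fl) := by
  induction Al generalizing φ with
  | nil =>
    obtain ⟨fl, hfl, hfN, rfl⟩ := exists_of_mem_formsP (h : φ ∈ formsP N Bl)
    exact ⟨[], fl, rfl, hfl, by simp, hfN, rfl⟩
  | cons a Al ih =>
    simp only [forms, List.mem_flatMap, List.map_map, List.mem_map, Function.comp] at h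
    obtain ⟨y, hy, b, hb, rfl⟩ := h
    obtain ⟨gl, fl, hgl, hfl, hgN, hfN, rfl⟩ := ih hy
    refine ⟨b :: gl, fl, by simp [hgl], hfl, fun b' hb' => ?_, hfN, rfl⟩
    rcases List.mem_cons.1 hb' with rfl | hb'
    · exact List.mem_range.1 hb
    · exact hgN b' hb'

/-- Members of a `zipWith`. [folklore] -/
theorem exists_of_mem_zipWith {α β γ : Type*} {f : α → β → γ} {w : γ} :
    ∀ {l₁ : List α} {l₂ : List β}, w ∈ List.zipWith f l₁ l₂ → ∃ x y, x ∈ l₁ ∧ y ∈ l₂ ∧ f x y = w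
  | [], _, h => by simp at h
  | _ :: _, [], h => by simp at h
  | x :: l₁, y :: l₂, h => by
    rw [List.zipWith_cons_cons, List.mem_cons] at h
    rcases h with rfl | h
    · exact ⟨x, y, List.mem_cons_self, List.mem_cons_self, rfl⟩
    · obtain ⟨x', y', hx', hy', rfl⟩ := exists_of_mem_zipWith h
      exact ⟨x', y', List.mem_cons_of_mem _ hx', List.mem_cons_of_mem _ hy', rfl⟩

/-- Case units are atoms. [folklore] -/
theorem caseUnits_atom {Bl Al gl fl : List ℕ} {w : PropForm ℕ} (hw : w ∈ caseUnits N Bl Al gl fl) :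
    ∃ b a, w = pv N b a := by
  simp only [caseUnits, List.mem_append] at hw
  rcases hw with hw | hw
  · obtain ⟨a, b, -, -, rfl⟩ := exists_of_mem_zipWith hw
    exact ⟨b, a, rfl⟩
  · obtain ⟨b, a, -, -, rfl⟩ := exists_of_mem_zipWith hw
    exact ⟨b, a, rfl⟩

/-- The number of case units. [folklore] -/
theorem length_caseUnits_le (Bl Al gl fl : List ℕ) :
    (caseUnits N Bl Al gl fl).length ≤ Al.length + Bl.length := by
  simp only [caseUnits, List.length_append, List.length_zipWith]; omega

/-- Member sum of a list of atoms. [folklore] -/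
theorem msum_atoms {W : List (PropForm ℕ)} (hW : ∀ w ∈ W, ∃ b a, w = pv N b a) : msum W = 2 * W.length := by
  induction W with
  | nil => simp
  | cons w W ih =>
    obtain ⟨b, a, rfl⟩ := hW w List.mem_cons_self
    rw [msum_cons, ih fun x hx => hW x (List.mem_cons_of_mem _ hx), List.length_cons, size_pv]; omega

/-- Size of a conjunction of atoms. [folklore] -/
theorem size_conjList_atoms {W : List (PropForm ℕ)} (hW : ∀ w ∈ W, ∃ b a, w = pv N b a) :
    (conjList W).size = 2 * W.length + 1 := by
  rw [size_conjList_eq_msum, msum_atoms hW]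

/-- Depth of a conjunction of atoms. [folklore] -/
theorem dd_conjList_atoms {W : List (PropForm ℕ)} (hW : ∀ w ∈ W, ∃ b a, w = pv N b a) :
    (conjList W).dd ≤ 2 :=
  dd_conjList_le (p := 0) fun X hX => by obtain ⟨b, a, rfl⟩ := hW X hX; simp

/-- Auxiliary depth (below `∧`) of a conjunction of atoms. [folklore] -/
theorem altDepthAux_two_conjList_atoms {W : List (PropForm ℕ)} (hW : ∀ w ∈ W, ∃ b a, w = pv N b a) :
    altDepthAux 2 (conjList W) ≤ 1 :=
  altDepthAux_two_conjList_le (p := 0) fun X hX => by obtain ⟨b, a, rfl⟩ := hW X hX; simp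

/-- Depth of a negated conjunction of atoms. [folklore] -/
theorem dd_neg_conjList_atoms {W : List (PropForm ℕ)} (hW : ∀ w ∈ W, ∃ b a, w = pv N b a) :
    (neg (conjList W)).dd ≤ 3 :=
  dd_neg_conjList_le (p := 0) fun X hX => by obtain ⟨b, a, rfl⟩ := hW X hX; simp

/-- The number of pigeon-sort case forms. [folklore] -/
theorem length_formsP (Bl : List ℕ) : (formsP N Bl).length = N ^ Bl.length := by
  induction Bl with
  | nil => rfl
  | cons b Bl ih =>
    rw [formsP, List.length_flatMap, List.length_cons, pow_succ]
    simp [ih, List.sum_replicate, Nat.mul_comm]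

/-- The number of case forms. [folklore] -/
theorem length_forms (Bl Al : List ℕ) : (forms N Bl Al).length = (N + 1) ^ Al.length * N ^ Bl.length := by
  induction Al with
  | nil => simp [forms, length_formsP]
  | cons a Al ih =>
    rw [forms, List.length_flatMap, List.length_cons, pow_succ]
    simp [ih, List.sum_replicate]
    ring

/-- The number of case forms, bounded. [folklore] -/
theorem length_forms_le (Bl Al : List ℕ) : (forms N Bl Al).length ≤ (N + 1) ^ (Al.length + Bl.length) := by
  rw [length_forms, pow_add]
  exact Nat.mul_le_mul_left _ (Nat.pow_le_pow_left (by omega) _)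

/-- Member sum of the case forms. [folklore] -/
theorem msum_forms_le (Bl Al : List ℕ) :
    msum (forms N Bl Al) ≤ (N + 1) ^ (Al.length + Bl.length) * (2 * (Al.length + Bl.length) + 2) := by
  have h1 : msum (forms N Bl Al) ≤ (forms N Bl Al).length * (2 * (Al.length + Bl.length) + 2) := by
    refine msum_le_length_mul fun X hX => ?_
    obtain ⟨gl, fl, -, -, -, -, rfl⟩ := exists_of_mem_forms hX
    rw [size_conjList_atoms (fun w hw => caseUnits_atom hw)]
    have := length_caseUnits_le (N := N) Bl Al gl fl
    omega
  exact h1.trans (Nat.mul_le_mul_right _ (length_forms_le Bl Al))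

/-! ### Distribution: some case holds -/

/-- **One distribution step**: from `⊢ Xs, ¬R` (a clause of `ontoPHP` as `≤ N+1` atoms) and
`⊢ Ys, ¬R` (the case forms so far, conjunctions of `≤ T` atoms, at most `(N+1)^T` of them) infer
`⊢ [x ∧ y]_{y,x}, ¬R`. [cite: KrajicekProofComplexity2019, §15.4 (proof of Lemma 15.4.3, Claim 1: induction on t)] -/
theorem stepS {Xs Ys : List (PropForm ℕ)} {ℓ₁ ℓ₂ T : ℕ}
    (hX : BD D B ℓ₁ (disjList (Xs ++ [neg (ophp N)])))
    (hY : BD D B ℓ₂ (disjList (Ys ++ [neg (ophp N)])))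
    (hXs : ∀ x ∈ Xs, ∃ b a, x = pv N b a) (hXlen : Xs.length ≤ N + 1)
    (hYs : ∀ y ∈ Ys, ∃ W, (∀ w ∈ W, ∃ b a, w = pv N b a) ∧ W.length ≤ T ∧ y = conjList W)
    (hYlen : Ys.length ≤ (N + 1) ^ T)
    (hD : 12 ≤ D) (hB : 100 * (T + 2) * (N + 1) ^ (T + 2) + 1000 * (N + 1) ^ 4 ≤ B) :
    BD D B (ℓ₁ + (N + 1) * ℓ₂ + 700 * (3 * (N + 1) ^ (T + 1) + 4) ^ 3)
      (disjList ((Ys.flatMap fun y => Xs.map fun x => conj x y) ++ [neg (ophp N)])) := by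
  set P := Ys.flatMap fun y => Xs.map fun x => conj x y with hP
  have hR := size_ophp_le (N := N)
  -- counting
  have hpow1 : (N + 1) ^ T ≤ (N + 1) ^ (T + 1) := Nat.pow_le_pow_right (by omega) (by omega)
  have hpow2 : (N + 1) ^ (T + 1) ≤ (N + 1) ^ (T + 2) := Nat.pow_le_pow_right (by omega) (by omega)
  have hpow3 : N + 1 ≤ (N + 1) ^ (T + 1) := by
    calc N + 1 = (N + 1) ^ 1 := (pow_one _).symm
      _ ≤ (N + 1) ^ (T + 1) := Nat.pow_le_pow_right (by omega) (by omega)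
  have hpow4 : (N + 1) ^ 4 ≥ 1 := Nat.one_le_pow _ _ (by omega)
  have hPlen : P.length ≤ (N + 1) ^ (T + 1) := by
    have : P.length = Ys.length * Xs.length := by
      rw [hP, List.length_flatMap]; simp [List.sum_replicate, Nat.mul_comm]
    rw [this, pow_succ]
    exact Nat.mul_le_mul hYlen hXlen
  -- sizes
  have hmsX : msum Xs = 2 * Xs.length := msum_atoms hXs
  have hmsY : msum Ys ≤ (N + 1) ^ T * (2 * T + 2) := by
    refine (msum_le_length_mul (W := 2 * T + 2) fun y hy => ?_).trans (Nat.mul_le_mul_right _ hYlen)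
    obtain ⟨W, hW, hWl, rfl⟩ := hYs y hy
    rw [size_conjList_atoms hW]; omega
  have hmsP : msum P ≤ (N + 1) ^ (T + 1) * (2 * T + 4) := by
    refine (msum_le_length_mul (W := 2 * T + 4) fun Z hZ => ?_).trans (Nat.mul_le_mul_right _ hPlen)
    rw [hP, List.mem_flatMap] at hZ
    obtain ⟨y, hy, hZ⟩ := hZ
    obtain ⟨x, hx, rfl⟩ := List.mem_map.1 hZ
    obtain ⟨W, hW, hWl, rfl⟩ := hYs y hy
    obtain ⟨b, a, rfl⟩ := hXs x hx
    simp only [size, size_pv, size_conjList_atoms hW]; omega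
  -- apply the product rule
  have h := productS (D := D) (B := B) (p := 4) (N := 3 * (N + 1) ^ (T + 1) + 4) (L := [neg (ophp N)])
    Xs Ys hX hY ?_ (by omega) ?_ ?_
  · refine h.mono ?_
    exact Nat.add_le_add_right (Nat.add_le_add_left (Nat.mul_le_mul_right _ hXlen) _) _
  · intro Z hZ
    simp only [List.mem_append, List.mem_cons, List.not_mem_nil, or_false] at hZ
    rcases hZ with (hZ | hZ) | rfl
    · obtain ⟨b, a, rfl⟩ := hXs Z hZ; simp
    · obtain ⟨W, hW, -, rfl⟩ := hYs Z hZ; exact (dd_conjList_atoms hW).trans (by omega)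
    · exact dd_neg_ophp_le
  · rw [← hP]; simp only [List.length_cons, List.length_nil]; omega
  · rw [← hP, msum_append, msum_append, msum_append, msum_cons, msum_nil]
    simp only [size]
    have e1 : (N + 1) ^ (T + 1) * (2 * T + 4) ≤ (N + 1) ^ (T + 2) * (2 * T + 4) :=
      Nat.mul_le_mul_right _ hpow2
    have e2 : (N + 1) ^ T * (2 * T + 2) ≤ (N + 1) ^ (T + 2) * (2 * T + 4) :=
      Nat.mul_le_mul (hpow1.trans hpow2) (by omega)
    have e3 : 100 * (T + 2) * (N + 1) ^ (T + 2) = (N + 1) ^ (T + 2) * (2 * T + 4) * 50 := by ring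
    have e4 : N + 1 ≤ (N + 1) ^ 4 := Nat.le_self_pow (by norm_num) _
    nlinarith [e1, e2, e3, e4, hmsP, hmsY, hmsX, hXlen, hR]

/-- The line count of the distribution over `t` slots: `formsCost N t`. [folklore] -/
def formsCost (N : ℕ) : ℕ → ℕ
  | 0 => 454
  | t + 1 => extractLines N + (N + 1) * formsCost N t + 700 * (3 * (N + 1) ^ (t + 1) + 4) ^ 3

/-- `formsCost` is monotone in the size budget implicit in `extractLines`… precisely: unfolding.
[folklore] -/
theorem formsCost_succ (N t : ℕ) : formsCost N (t + 1) =
    extractLines N + (N + 1) * formsCost N t + 700 * (3 * (N + 1) ^ (t + 1) + 4) ^ 3 := rfl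

/-- **Some pigeon-sort case holds**: `⊢ formsP Bl, ¬R`. [cite: KrajicekProofComplexity2019, §15.4 (proof of Lemma 15.4.3, Claim 1)] -/
theorem formsPS {T : ℕ} (hD : 12 ≤ D)
    (hB : 100 * (T + 2) * (N + 1) ^ (T + 2) + 1000 * (N + 1) ^ 4 ≤ B) :
    ∀ Bl : List ℕ, (∀ b ∈ Bl, b < N + 1) → Bl.length ≤ T →
      BD D B (formsCost N Bl.length) (disjList (formsP N Bl ++ [neg (ophp N)]))
  | [], _, _ => by
    have hR := size_ophp_le (N := N)
    have hpow4 : (N + 1) ^ 4 ≥ 1 := Nat.one_le_pow _ _ (by omega)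
    have hpowT : 1 ≤ (N + 1) ^ (T + 2) := Nat.one_le_pow _ _ (by omega)
    rw [formsP, List.length_nil, formsCost, List.singleton_append]
    have h0 : BD D B 4 (disjList [const true]) := topS (by omega) (by omega)
    refine (subsetN (N := 2) (L' := [const true, neg (ophp N)]) h0 (by simp) (p := 4) ?_ (by omega)
      ?_ (by simp) (by simp)).mono (by norm_num)
    · intro X hX
      simp only [List.mem_cons, List.not_mem_nil, or_false] at hX
      rcases hX with rfl | rfl
      · simp
      · exact dd_neg_ophp_le
    · simp only [size_disjList_cons, size_disjList_nil, size]; nlinarith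
  | b :: Bl, hBl, hlen => by
    have hb := hBl b List.mem_cons_self
    have hBl' : ∀ b' ∈ Bl, b' < N + 1 := fun b' hb' => hBl b' (List.mem_cons_of_mem _ hb')
    rw [List.length_cons] at hlen
    have ih := formsPS hD hB Bl hBl' (by omega)
    have hX := pigeonS (D := D) (B := B) hb hD (by
      have : 0 < 100 * (T + 2) * (N + 1) ^ (T + 2) := by positivity
      omega)
    rw [formsP, List.length_cons, formsCost_succ]
    have h := stepS (T := Bl.length) hX ih (fun x hx => by
        obtain ⟨a, -, rfl⟩ := List.mem_map.1 hx; exact ⟨b, a, rfl⟩)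
      (by simp) (fun y hy => by
        obtain ⟨fl, hfl, -, rfl⟩ := exists_of_mem_formsP hy
        refine ⟨_, fun w hw => ?_, ?_, rfl⟩
        · obtain ⟨b', a, -, -, rfl⟩ := exists_of_mem_zipWith hw
          exact ⟨b', a, rfl⟩
        · rw [List.length_zipWith]; omega)
      (by rw [length_formsP]; exact Nat.pow_le_pow_left (by omega) _) hD
      (by
        have e1 : (N + 1) ^ (Bl.length + 2) ≤ (N + 1) ^ (T + 2) := Nat.pow_le_pow_right (by omega) (by omega)
        have e2 : 100 * (Bl.length + 2) * (N + 1) ^ (Bl.length + 2) ≤ 100 * (T + 2) * (N + 1) ^ (T + 2) :=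
          Nat.mul_le_mul (by omega) e1
        omega)
    exact h.mono le_rfl

/-- **Some case holds**: `⊢ forms Bl Al, ¬R` — every local assignment (a hole for each pigeon of
`Bl`, a pigeon for each hole of `Al`) is excluded only if `ontoPHP` fails; `formsCost N (|Bl|+|Al|)`
lines. [cite: KrajicekProofComplexity2019, §15.4 (proof of Lemma 15.4.3, Claim 1)] -/
theorem formsS {Bl : List ℕ} {T : ℕ} (hBl : ∀ b ∈ Bl, b < N + 1) (hD : 12 ≤ D)
    (hB : 100 * (T + 2) * (N + 1) ^ (T + 2) + 1000 * (N + 1) ^ 4 ≤ B) :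
    ∀ Al : List ℕ, (∀ a ∈ Al, a < N) → Bl.length + Al.length ≤ T →
      BD D B (formsCost N (Bl.length + Al.length)) (disjList (forms N Bl Al ++ [neg (ophp N)]))
  | [], _, hlen => by
    rw [List.length_nil, Nat.add_zero]
    exact formsPS hD hB Bl hBl (by omega)
  | a :: Al, hAl, hlen => by
    have ha := hAl a List.mem_cons_self
    have hAl' : ∀ a' ∈ Al, a' < N := fun a' ha' => hAl a' (List.mem_cons_of_mem _ ha')
    rw [List.length_cons] at hlen
    have ih := formsS hBl hD hB Al hAl' (by omega)
    have hX := ontoS (D := D) (B := B) ha hD (by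
      have : 0 < 100 * (T + 2) * (N + 1) ^ (T + 2) := by positivity
      omega)
    rw [List.length_cons, ← Nat.add_assoc, forms, formsCost_succ]
    have h := stepS (T := Bl.length + Al.length) hX ih (fun x hx => by
        obtain ⟨b, -, rfl⟩ := List.mem_map.1 hx; exact ⟨b, a, rfl⟩)
      (by simp) (fun y hy => by
        obtain ⟨gl, fl, -, -, -, -, rfl⟩ := exists_of_mem_forms hy
        exact ⟨_, fun w hw => caseUnits_atom hw, by
          have := length_caseUnits_le (N := N) Bl Al gl fl; omega, rfl⟩)
      (by have := length_forms_le (N := N) Bl Al; rwa [Nat.add_comm Al.length] at this) hD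
      (by
        have e1 : (N + 1) ^ (Bl.length + Al.length + 2) ≤ (N + 1) ^ (T + 2) :=
          Nat.pow_le_pow_right (by omega) (by omega)
        have e2 : 100 * (Bl.length + Al.length + 2) * (N + 1) ^ (Bl.length + Al.length + 2) ≤
            100 * (T + 2) * (N + 1) ^ (T + 2) := Nat.mul_le_mul (by omega) e1
        omega)
    exact h.mono le_rfl

end OntoPHPReduction

end Literature.Computability.MetaComplexity
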